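import Summits.CriticalPhenomena.SAWScalingLimit.Theorems.BoundaryTP2.Negative.TP2CertGraphFull
import Summits.CriticalPhenomena.SAWScalingLimit.Theorems.BoundaryTP2.Negative.TP2CertTaylor
import HarnessLib

/-!
# Crux `BoundaryTP2` (stmt-CriticalPhenomena-7115): graph-level certificates with the sharper cell test

Certified-compute seat (refuter `ccert`), part 8: the assembly theorems of parts 4–5 (`certAll`, `fullCheckAtV`,
`tp2_graph_of_certAll`, `graphTP2_of_fullCheckV` — here also the interlacing-only
strengthening `interlacedTP2_of_fullCheckVTR` —, `tp2_weight_ΩV_of_certAll`, `boundaryTP2_ΩV_of_fullCheckV`)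
re-issued with the subdivision `certRecT` of part 7 (old monotone test OR exact shifted-Taylor enclosure per
cell), which certifies slit-mouth quadruples of relative margin `10⁻⁴` in a single cell.  Names carry a `T`; the full check is CHUNKED by a range of second indices (`fullCheckVTR … i₁ lo hi`) so that instances can keep each kernel `decide` small.
Everything proved. [folklore]
-/

namespace Summit.CriticalPhenomena.SAWScalingLimit.Theorems.BoundaryTP2.Negative.Cert

open Literature.Probability.LatticeModels Literature.Probability.RandomPlanarGeometry
open Summit.CriticalPhenomena.SAWScalingLimit.Theorems.EdgeOfPositivity.Negative
open Summit.CriticalPhenomena.SAWScalingLimit.Theorems.BoundaryTP2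
open scoped ENNReal

/-! ## §1 All quadruples of a listed cycle -/

/-- Both non-crossing pairings dominate the crossing one (sharper test). [folklore] -/
def quadOKT (K F : ℕ) (ctab : List (List (List ℕ))) (i j k l : ℕ) : Bool :=
  certRecT K (cf ctab i j) (cf ctab k l) (cf ctab i k) (cf ctab j l) F 0 0 &&
    certRecT K (cf ctab i l) (cf ctab j k) (cf ctab i k) (cf ctab j l) F 0 0

/-- **The certificate** (sharper test): table lengths and all `C(m,4)` quadruples. [folklore] -/
def certAllT (m K F : ℕ) (ctab : List (List (List ℕ))) : Bool :=
  lenOK K ctab && (List.range m).all fun l => (List.range l).all fun k =>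
    (List.range k).all fun j => (List.range j).all fun i => quadOKT K F ctab i j k l

/-- Soundness of `certAllT` at the level of coefficient vectors. [folklore] -/
theorem poly_of_certAllT {m K F : ℕ} {ctab : List (List (List ℕ))} (h : certAllT m K F ctab = true)
    {i j k l : ℕ} (hij : i < j) (hjk : j < k) (hkl : k < l) (hl : l < m) {x : ℝ}
    (hlo : 10 / 27 ≤ x) (hhi : x ≤ 5 / 13) :
    evPoly (cf ctab i k) x * evPoly (cf ctab j l) x ≤ evPoly (cf ctab i j) x * evPoly (cf ctab k l) x ∧
    evPoly (cf ctab i k) x * evPoly (cf ctab j l) x ≤ evPoly (cf ctab i l) x * evPoly (cf ctab j k) x := by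
  simp only [certAllT, Bool.and_eq_true, List.all_eq_true, List.mem_range] at h
  obtain ⟨hlen, hall⟩ := h
  have hq := hall l hl k hkl j hjk i hij
  simp only [quadOKT, Bool.and_eq_true] at hq
  have h1 : tR 0 0 ≤ x := by rw [tR_zero_zero]; exact hlo
  have h2 : x ≤ tR 0 (0 + 1) := by rw [zero_add, tR_zero_one]; exact hhi
  have hL := fun i j => length_cf_le hlen i j
  exact ⟨certRecT_sound (hL i j) (hL k l) (hL i k) (hL j l) F 0 0 hq.1 h1 h2,
    certRecT_sound (hL i l) (hL j k) (hL i k) (hL j l) F 0 0 hq.2 h1 h2⟩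


/-! ## §2 Circular TP₂ for a listed cycle of `ℤ²[VS]` -/

/-- **Circular TP₂ for a list of sites of `ℤ²[VS]` from the sharper certificate** (both non-crossing pairings dominate
the crossing one, all `i < j < k < l`, all `x ∈ [10/27, 5/13]`). [folklore] -/
theorem tp2_graph_of_certAllT {VS : List (Site 2)} {G : SimpleGraph (Site 2)}
    (hG : ∀ x y, G.Adj x y ↔ (zdGraph 2).Adj x y ∧ x ∈ VS ∧ y ∈ VS) (hVS : VS.Nodup)
    {bd : List (Site 2)} (hbd : ∀ u ∈ bd, u ∈ VS) {ctab : List (List (List ℕ))}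
    (hct : (rowsOf bd).map (List.map fun p : Site 2 × Site 2 => pathCountV VS p.1 p.2) = ctab)
    {K F : ℕ} (hcert : certAllT bd.length K F ctab = true) {x : ℝ} (hlo : 10 / 27 ≤ x) (hhi : x ≤ 5 / 13)
    {i j k l : ℕ} (hij : i < j) (hjk : j < k) (hkl : k < l) (hl : l < bd.length) :
    pathKernel G x (bd.getD i 0) (bd.getD k 0) * pathKernel G x (bd.getD j 0) (bd.getD l 0) ≤
        pathKernel G x (bd.getD i 0) (bd.getD j 0) * pathKernel G x (bd.getD k 0) (bd.getD l 0) ∧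
      pathKernel G x (bd.getD i 0) (bd.getD k 0) * pathKernel G x (bd.getD j 0) (bd.getD l 0) ≤
        pathKernel G x (bd.getD i 0) (bd.getD l 0) * pathKernel G x (bd.getD j 0) (bd.getD k 0) := by
  have hx : 0 ≤ x := le_trans (by norm_num) hlo
  have hmem : ∀ n, n < bd.length → bd.getD n 0 ∈ VS := fun n hn => by
    rw [List.getD_eq_getElem _ _ hn]; exact hbd _ (List.getElem_mem hn)
  have hZ : ∀ {s t : ℕ}, s < t → t < bd.length →
      pathKernel G x (bd.getD s 0) (bd.getD t 0) = ENNReal.ofReal (evPoly (cf ctab s t) x) := by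
    intro s t hst ht
    rw [pathKernel_eq_evPolyV hG hVS (hmem s (hst.trans ht)) hx, cf_eq_apply hct hst ht]
  obtain ⟨h1, h2⟩ := poly_of_certAllT hcert hij hjk hkl hl hlo hhi
  have hik : i < k := hij.trans hjk
  have hjl : j < l := hjk.trans hkl
  have hil : i < l := hik.trans hkl
  have hk : k < bd.length := hkl.trans hl
  have hj : j < bd.length := hjk.trans hk
  rw [hZ hik hk, hZ hjl hl, hZ hij hj, hZ hkl hl, hZ hil hl, hZ hjk hk,
    ← ENNReal.ofReal_mul (evPoly_nonneg _ hx), ← ENNReal.ofReal_mul (evPoly_nonneg _ hx),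
    ← ENNReal.ofReal_mul (evPoly_nonneg _ hx)]
  exact ⟨ENNReal.ofReal_le_ofReal h1, ENNReal.ofReal_le_ofReal h2⟩


/-! ## §3 The full check with the sharper test -/

section FullT

/-- One ordered quadruple of listed-site indices: certificate, else witness. [folklore] -/
def quadFullVT (VS : List (Site 2)) (K F : ℕ) (ctab : List (List (List ℕ))) (i₁ i₂ i₃ i₄ : ℕ) : Bool :=
  (!violatedLoV K (cfsV ctab i₁ i₂) (cfsV ctab i₃ i₄) (cfsV ctab i₁ i₃) (cfsV ctab i₂ i₄) &&
      certRecT K (cfsV ctab i₁ i₂) (cfsV ctab i₃ i₄) (cfsV ctab i₁ i₃) (cfsV ctab i₂ i₄) F 0 0) ||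
    disjointWitnessV VS (VS.getD i₁ 0) (VS.getD i₂ 0) (VS.getD i₃ 0) (VS.getD i₄ 0)

/-- **The full checker at first index `i₁`, second index in `[lo, hi)`** (chunked to bound the kernel's memory per
declaration): table lengths, and every ordered quadruple of pairwise distinct indices with `i₁` minimal. [folklore] -/
def fullCheckVTR (VS : List (Site 2)) (K F : ℕ) (ctab : List (List (List ℕ))) (i₁ lo hi : ℕ) : Bool :=
  lenOK K ctab &&
    (List.range VS.length).all fun i₂ => !(decide (lo ≤ i₂) && decide (i₂ < hi)) ||
      (List.range VS.length).all fun i₃ => (List.range VS.length).all fun i₄ =>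
        !(decide (i₁ < i₂) && decide (i₁ < i₃) && decide (i₁ < i₄) && !(i₂ == i₃) && !(i₂ == i₄) && !(i₃ == i₄)) ||
          quadFullVT VS K F ctab i₁ i₂ i₃ i₄

/-! ## §3 Soundness -/

variable {VS : List (Site 2)} {G : SimpleGraph (Site 2)} {K F : ℕ} {ctab : List (List (List ℕ))}

/-- **Soundness in canonical position** (`i₁` minimal). [folklore] -/
theorem tp2_canonical_of_fullCheckVTR (hG : ∀ x y, G.Adj x y ↔ (zdGraph 2).Adj x y ∧ x ∈ VS ∧ y ∈ VS)
    (hVS : VS.Nodup) (hct : (rowsOf VS).map (List.map fun p : Site 2 × Site 2 => pathCountV VS p.1 p.2) = ctab)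
    {i₁ lo hi : ℕ} (h : fullCheckVTR VS K F ctab i₁ lo hi = true) {i₂ i₃ i₄ : ℕ} (hlo₂ : lo ≤ i₂) (hhi₂ : i₂ < hi)
    (h12 : i₁ < i₂) (h13 : i₁ < i₃)
    (h14 : i₁ < i₄) (h23 : i₂ ≠ i₃) (h24 : i₂ ≠ i₄) (h34 : i₃ ≠ i₄) (hi₂ : i₂ < VS.length)
    (hi₃ : i₃ < VS.length) (hi₄ : i₄ < VS.length) {x : ℝ} (hlo : 10 / 27 ≤ x) (hhi : x ≤ 5 / 13)
    (hI : Interlaced G (VS.getD i₁ 0) (VS.getD i₂ 0) (VS.getD i₃ 0) (VS.getD i₄ 0)) :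
    pathKernel G x (VS.getD i₁ 0) (VS.getD i₃ 0) * pathKernel G x (VS.getD i₂ 0) (VS.getD i₄ 0) ≤
      pathKernel G x (VS.getD i₁ 0) (VS.getD i₂ 0) * pathKernel G x (VS.getD i₃ 0) (VS.getD i₄ 0) := by
  have hi₁ : i₁ < VS.length := h12.trans hi₂
  have hx : 0 ≤ x := le_trans (by norm_num) hlo
  simp only [fullCheckVTR, Bool.and_eq_true, List.all_eq_true, List.mem_range] at h
  obtain ⟨hlen, hall⟩ := h
  have hq₂ := hall i₂ hi₂
  have hr : (decide (lo ≤ i₂) && decide (i₂ < hi)) = true := by simp [hlo₂, hhi₂]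
  rw [hr] at hq₂
  simp only [Bool.not_true, Bool.false_or, List.all_eq_true, List.mem_range] at hq₂
  have hq := hq₂ i₃ hi₃ i₄ hi₄
  have hguard : (decide (i₁ < i₂) && decide (i₁ < i₃) && decide (i₁ < i₄) && !(i₂ == i₃) && !(i₂ == i₄) &&
      !(i₃ == i₄)) = true := by simp [h12, h13, h14, h23, h24, h34]
  rw [hguard] at hq
  simp only [Bool.not_true, Bool.false_or, quadFullVT, Bool.or_eq_true, Bool.and_eq_true] at hq
  rcases hq with ⟨-, hcert⟩ | hwit
  · have hL := fun i j => show (cfsV ctab i j).length ≤ K + 1 by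
      unfold cfsV; split_ifs <;> exact length_cf_le hlen _ _
    have h1 : tR 0 0 ≤ x := by rw [tR_zero_zero]; exact hlo
    have h2 : x ≤ tR 0 (0 + 1) := by rw [zero_add, tR_zero_one]; exact hhi
    have key := certRecT_sound (hL i₁ i₂) (hL i₃ i₄) (hL i₁ i₃) (hL i₂ i₄) F 0 0 hcert h1 h2
    rw [pathKernel_eq_cfsV hG hVS hct (ne_of_lt h13) hi₁ hi₃ hx, pathKernel_eq_cfsV hG hVS hct h24 hi₂ hi₄ hx,
      pathKernel_eq_cfsV hG hVS hct (ne_of_lt h12) hi₁ hi₂ hx, pathKernel_eq_cfsV hG hVS hct h34 hi₃ hi₄ hx,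
      ← ENNReal.ofReal_mul (evPoly_nonneg _ hx), ← ENNReal.ofReal_mul (evPoly_nonneg _ hx)]
    exact ENNReal.ofReal_le_ofReal key
  · have hmem : ∀ n, n < VS.length → VS.getD n 0 ∈ VS := fun n hn => by
      rw [List.getD_eq_getElem _ _ hn]; exact List.getElem_mem hn
    have hne : VS.getD i₁ 0 ≠ VS.getD i₂ 0 := by
      rw [List.getD_eq_getElem _ _ hi₁, List.getD_eq_getElem _ _ hi₂, Ne, hVS.getElem_inj_iff]
      exact ne_of_lt h12
    exact absurd hI (not_interlaced_of_disjointWitnessV hG hwit (hmem i₁ hi₁) (hmem i₂ hi₂) hne)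

/-- **Interlacing-only TP₂ on `ℤ²[VS]`, listed pairwise distinct points.** [folklore] -/
theorem interlacedTP2_mem_of_fullCheckVTR (hG : ∀ x y, G.Adj x y ↔ (zdGraph 2).Adj x y ∧ x ∈ VS ∧ y ∈ VS)
    (hVS : VS.Nodup) (hct : (rowsOf VS).map (List.map fun p : Site 2 × Site 2 => pathCountV VS p.1 p.2) = ctab)
    (hall : ∀ i₁ < VS.length, ∀ i₂ < VS.length, ∃ lo hi, lo ≤ i₂ ∧ i₂ < hi ∧ fullCheckVTR VS K F ctab i₁ lo hi = true)
    {x : ℝ} (hlo : 10 / 27 ≤ x) (hhi : x ≤ 5 / 13) {p₁ p₂ p₃ p₄ : Site 2} (m₁ : p₁ ∈ VS) (m₂ : p₂ ∈ VS)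
    (m₃ : p₃ ∈ VS) (m₄ : p₄ ∈ VS) (n12 : p₁ ≠ p₂) (n13 : p₁ ≠ p₃) (n14 : p₁ ≠ p₄) (n23 : p₂ ≠ p₃) (n24 : p₂ ≠ p₄)
    (n34 : p₃ ≠ p₄) (hI : Interlaced G p₁ p₂ p₃ p₄) :
    pathKernel G x p₁ p₃ * pathKernel G x p₂ p₄ ≤ pathKernel G x p₁ p₂ * pathKernel G x p₃ p₄ := by
  -- indices
  have idx : ∀ {p : Site 2}, p ∈ VS → ∃ i, i < VS.length ∧ VS.getD i 0 = p := by
    intro p hp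
    obtain ⟨i, hi, hip⟩ := List.mem_iff_getElem.1 hp
    exact ⟨i, hi, by rw [List.getD_eq_getElem _ _ hi, hip]⟩
  obtain ⟨i₁, hi₁, rfl⟩ := idx m₁
  obtain ⟨i₂, hi₂, rfl⟩ := idx m₂
  obtain ⟨i₃, hi₃, rfl⟩ := idx m₃
  obtain ⟨i₄, hi₄, rfl⟩ := idx m₄
  have d12 : i₁ ≠ i₂ := fun h => n12 (by rw [h])
  have d13 : i₁ ≠ i₃ := fun h => n13 (by rw [h])
  have d14 : i₁ ≠ i₄ := fun h => n14 (by rw [h])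
  have d23 : i₂ ≠ i₃ := fun h => n23 (by rw [h])
  have d24 : i₂ ≠ i₄ := fun h => n24 (by rw [h])
  have d34 : i₃ ≠ i₄ := fun h => n34 (by rw [h])
  -- which index is minimal?
  rcases lt_or_gt_of_ne d12 with h12 | h12 <;> rcases lt_or_gt_of_ne d13 with h13 | h13 <;>
    rcases lt_or_gt_of_ne d14 with h14 | h14 <;> rcases lt_or_gt_of_ne d23 with h23 | h23 <;>
    rcases lt_or_gt_of_ne d24 with h24 | h24 <;> rcases lt_or_gt_of_ne d34 with h34 | h34
  all_goals first
    -- `i₁` minimal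
    | exact (by obtain ⟨lo, hi, hl, hh, hc⟩ := hall i₁ hi₁ i₂ hi₂
                exact tp2_canonical_of_fullCheckVTR hG hVS hct hc hl hh h12 h13 h14 d23 d24 d34 hi₂ hi₃ hi₄ hlo
                  hhi hI)
    -- `i₂` minimal: relabel `(12)(34)`
    | exact (by obtain ⟨lo, hi, hl, hh, hc⟩ := hall i₂ hi₂ i₁ hi₁
                exact tp2_of_swap _ x (tp2_canonical_of_fullCheckVTR hG hVS hct hc hl hh h12 h24 h23 d14 d13
                  d34.symm hi₁ hi₄ hi₃ hlo hhi hI.swap))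
    -- `i₃` minimal: relabel `(13)(24)`
    | exact (by obtain ⟨lo, hi, hl, hh, hc⟩ := hall i₃ hi₃ i₄ hi₄
                exact tp2_of_rotate _ x (tp2_canonical_of_fullCheckVTR hG hVS hct hc hl hh h34 h13 h23 d14.symm
                  d24.symm d12 hi₄ hi₁ hi₂ hlo hhi hI.rotate))
    -- `i₄` minimal: relabel `(14)(23)`
    | exact (by obtain ⟨lo, hi, hl, hh, hc⟩ := hall i₄ hi₄ i₃ hi₃
                exact tp2_of_reflect _ x (tp2_canonical_of_fullCheckVTR hG hVS hct hc hl hh h34 h24 h14 d23.symm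
                  d13.symm d12.symm hi₃ hi₂ hi₁ hlo hhi hI.reflect))
    | omega

/-- Off the site list the kernel between distinct points vanishes. [folklore] -/
theorem pathKernel_eq_zero_of_not_mem (hG : ∀ x y, G.Adj x y ↔ (zdGraph 2).Adj x y ∧ x ∈ VS ∧ y ∈ VS)
    {u v : Site 2} (hu : u ∉ VS) (huv : u ≠ v) (x : ℝ) : pathKernel G x u v = 0 := by
  refine pathKernel_eq_zero_of_not_reachable G x ?_
  rintro ⟨p⟩
  cases p with
  | nil => exact huv rfl
  | cons h _ => exact hu ((hG _ _).1 h).2.1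

/-- **Interlacing-only TP₂ on the whole of `ℤ²[VS]`** (the strengthening `InterlacedTP2At` restricted to `G`): for
pairwise distinct points, interlacing alone gives TP₂ at every `x ∈ [10/27, 5/13]` (points off `VS` carry no path, so
the crossing product vanishes there). [folklore] -/
theorem interlacedTP2_of_fullCheckVTR (hG : ∀ x y, G.Adj x y ↔ (zdGraph 2).Adj x y ∧ x ∈ VS ∧ y ∈ VS)
    (hVS : VS.Nodup) (hct : (rowsOf VS).map (List.map fun p : Site 2 × Site 2 => pathCountV VS p.1 p.2) = ctab)
    (hall : ∀ i₁ < VS.length, ∀ i₂ < VS.length, ∃ lo hi, lo ≤ i₂ ∧ i₂ < hi ∧ fullCheckVTR VS K F ctab i₁ lo hi = true)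
    {x : ℝ} (hlo : 10 / 27 ≤ x) (hhi : x ≤ 5 / 13) (p₁ p₂ p₃ p₄ : Site 2) (n12 : p₁ ≠ p₂) (n13 : p₁ ≠ p₃)
    (n14 : p₁ ≠ p₄) (n23 : p₂ ≠ p₃) (n24 : p₂ ≠ p₄) (n34 : p₃ ≠ p₄) (hI : Interlaced G p₁ p₂ p₃ p₄) :
    pathKernel G x p₁ p₃ * pathKernel G x p₂ p₄ ≤ pathKernel G x p₁ p₂ * pathKernel G x p₃ p₄ := by
  by_cases m₁ : p₁ ∈ VS
  · by_cases m₃ : p₃ ∈ VS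
    · by_cases m₂ : p₂ ∈ VS
      · by_cases m₄ : p₄ ∈ VS
        · exact interlacedTP2_mem_of_fullCheckVTR hG hVS hct hall hlo hhi m₁ m₂ m₃ m₄ n12 n13 n14 n23 n24 n34 hI
        · rw [pathKernel_comm G x p₂ p₄, pathKernel_eq_zero_of_not_mem hG m₄ n24.symm, mul_zero]; exact bot_le
      · rw [pathKernel_eq_zero_of_not_mem hG m₂ n24, mul_zero]; exact bot_le
    · rw [pathKernel_comm G x p₁ p₃, pathKernel_eq_zero_of_not_mem hG m₃ n13.symm, zero_mul]; exact bot_le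
  · rw [pathKernel_eq_zero_of_not_mem hG m₁ n13, zero_mul]; exact bot_le

/-- **TP₂ on the whole of `ℤ²[VS]` with the crux's hypotheses**: every interlaced, disjointly realisable quadruple
of `G` satisfies TP₂ at every `x ∈ [10/27, 5/13]`. [folklore] -/
theorem graphTP2_of_fullCheckVTR (hG : ∀ x y, G.Adj x y ↔ (zdGraph 2).Adj x y ∧ x ∈ VS ∧ y ∈ VS)
    (hVS : VS.Nodup) (hct : (rowsOf VS).map (List.map fun p : Site 2 × Site 2 => pathCountV VS p.1 p.2) = ctab)
    (hall : ∀ i₁ < VS.length, ∀ i₂ < VS.length, ∃ lo hi, lo ≤ i₂ ∧ i₂ < hi ∧ fullCheckVTR VS K F ctab i₁ lo hi = true)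
    {x : ℝ} (hlo : 10 / 27 ≤ x) (hhi : x ≤ 5 / 13) (p₁ p₂ p₃ p₄ : Site 2) (hI : Interlaced G p₁ p₂ p₃ p₄)
    (hD₁ : DisjointPaths G p₁ p₂ p₃ p₄) (hD₂ : DisjointPaths G p₁ p₄ p₂ p₃) :
    pathKernel G x p₁ p₃ * pathKernel G x p₂ p₄ ≤ pathKernel G x p₁ p₂ * pathKernel G x p₃ p₄ := by
  obtain ⟨n12, n13, n14, n23, n24, n34⟩ := pairwise_ne_of_disjointPaths hD₁ hD₂
  exact interlacedTP2_of_fullCheckVTR hG hVS hct hall hlo hhi p₁ p₂ p₃ p₄ n12 n13 n14 n23 n24 n34 hI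

end FullT


/-! ## §4 The sharper certificates in the crux's own terms on `ΩV` -/

/-- **Circular TP₂ of the critical SAW kernel of `ΩV` for a listed cycle `bd ⊆ VS`** (both non-crossing
pairings dominate the crossing one for all `i < j < k < l`; `Z = SAW.weight (ΩV lo hi VS) 1 · · univ`), under
the quoted bounds `2.6 ≤ μ ≤ 2.7`. [folklore] -/
theorem tp2_weight_ΩV_of_certAllT (hμ : SAW.LawlerSchrammWerner2004SAW_connectiveConstant_bounds)
    {lo hi : Site 2} {VS : List (Site 2)} (hV : ∀ v ∈ VS, v ∈ boxSites lo hi) (hconn : connCheck VS = true)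
    (hVS : VS.Nodup) {bd : List (Site 2)} (hbd : ∀ u ∈ bd, u ∈ VS) {ctab : List (List (List ℕ))}
    (hct : (rowsOf bd).map (List.map fun p : Site 2 × Site 2 => pathCountV VS p.1 p.2) = ctab)
    {K F : ℕ} (hcert : certAllT bd.length K F ctab = true)
    {i j k l : ℕ} (hij : i < j) (hjk : j < k) (hkl : k < l) (hl : l < bd.length) :
    SAW.weight (ΩV lo hi VS) 1 (bd.getD i 0) (bd.getD k 0) Set.univ *
          SAW.weight (ΩV lo hi VS) 1 (bd.getD j 0) (bd.getD l 0) Set.univ ≤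
        SAW.weight (ΩV lo hi VS) 1 (bd.getD i 0) (bd.getD j 0) Set.univ *
          SAW.weight (ΩV lo hi VS) 1 (bd.getD k 0) (bd.getD l 0) Set.univ ∧
      SAW.weight (ΩV lo hi VS) 1 (bd.getD i 0) (bd.getD k 0) Set.univ *
          SAW.weight (ΩV lo hi VS) 1 (bd.getD j 0) (bd.getD l 0) Set.univ ≤
        SAW.weight (ΩV lo hi VS) 1 (bd.getD i 0) (bd.getD l 0) Set.univ *
          SAW.weight (ΩV lo hi VS) 1 (bd.getD j 0) (bd.getD k 0) Set.univ := by
  simp only [weight_univ_eq_pathKernel]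
  exact tp2_graph_of_certAllT (adj_ΩV_iff hV hconn) hVS hbd hct hcert (xc_mem_interval hμ).1
    (xc_mem_interval hμ).2 hij hjk hkl hl

/-- **The crux `BoundaryTP2` holds on `Ω = ΩV lo hi VS`, `δ = 1`, as typed** (all quadruples;
`Z = SAW.weight … univ` at `x_c`), under the quoted bounds `2.6 ≤ μ ≤ 2.7`, given the all-pairs table and the
kernel checks. [folklore] -/
theorem boundaryTP2_ΩV_of_fullCheckVTR (hμ : SAW.LawlerSchrammWerner2004SAW_connectiveConstant_bounds)
    {lo hi : Site 2} {VS : List (Site 2)} (hV : ∀ v ∈ VS, v ∈ boxSites lo hi) (hconn : connCheck VS = true)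
    (hVS : VS.Nodup) {ctab : List (List (List ℕ))}
    (hct : (rowsOf VS).map (List.map fun p : Site 2 × Site 2 => pathCountV VS p.1 p.2) = ctab)
    {K F : ℕ}
    (hall : ∀ i₁ < VS.length, ∀ i₂ < VS.length, ∃ lo hi, lo ≤ i₂ ∧ i₂ < hi ∧ fullCheckVTR VS K F ctab i₁ lo hi = true)
    (p₁ p₂ p₃ p₄ : Site 2)
    (hI : ∀ (P : SAW.DomainSAW (ΩV lo hi VS) 1 p₁ p₃) (Q : SAW.DomainSAW (ΩV lo hi VS) 1 p₂ p₄),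
      ∃ v, v ∈ P.walk.support ∧ v ∈ Q.walk.support)
    (hD₁ : ∃ (P : SAW.DomainSAW (ΩV lo hi VS) 1 p₁ p₂) (Q : SAW.DomainSAW (ΩV lo hi VS) 1 p₃ p₄),
      List.Disjoint P.walk.support Q.walk.support)
    (hD₂ : ∃ (P : SAW.DomainSAW (ΩV lo hi VS) 1 p₁ p₄) (Q : SAW.DomainSAW (ΩV lo hi VS) 1 p₂ p₃),
      List.Disjoint P.walk.support Q.walk.support) :
    SAW.weight (ΩV lo hi VS) 1 p₁ p₃ Set.univ * SAW.weight (ΩV lo hi VS) 1 p₂ p₄ Set.univ ≤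
      SAW.weight (ΩV lo hi VS) 1 p₁ p₂ Set.univ * SAW.weight (ΩV lo hi VS) 1 p₃ p₄ Set.univ := by
  simp only [weight_univ_eq_pathKernel]
  exact graphTP2_of_fullCheckVTR (adj_ΩV_iff hV hconn) hVS hct hall (xc_mem_interval hμ).1
    (xc_mem_interval hμ).2 p₁ p₂ p₃ p₄ (interlaced_of_domainSAW hI) (disjointPaths_of_domainSAW hD₁)
    (disjointPaths_of_domainSAW hD₂)


/-- **Interlacing alone suffices on `Ω = ΩV lo hi VS`, `δ = 1`**: for pairwise distinct lattice points, hypothesis (i) of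
`BoundaryTP2` already gives its conclusion (`Z = SAW.weight … univ` at `x_c`), under the quoted bounds `2.6 ≤ μ ≤ 2.7`,
given the all-pairs table and the kernel checks. [folklore] -/
theorem interlacedTP2_ΩV_of_fullCheckVTR (hμ : SAW.LawlerSchrammWerner2004SAW_connectiveConstant_bounds)
    {lo hi : Site 2} {VS : List (Site 2)} (hV : ∀ v ∈ VS, v ∈ boxSites lo hi) (hconn : connCheck VS = true)
    (hVS : VS.Nodup) {ctab : List (List (List ℕ))}
    (hct : (rowsOf VS).map (List.map fun p : Site 2 × Site 2 => pathCountV VS p.1 p.2) = ctab)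
    {K F : ℕ}
    (hall : ∀ i₁ < VS.length, ∀ i₂ < VS.length, ∃ lo hi, lo ≤ i₂ ∧ i₂ < hi ∧ fullCheckVTR VS K F ctab i₁ lo hi = true)
    (p₁ p₂ p₃ p₄ : Site 2) (n12 : p₁ ≠ p₂) (n13 : p₁ ≠ p₃) (n14 : p₁ ≠ p₄) (n23 : p₂ ≠ p₃) (n24 : p₂ ≠ p₄)
    (n34 : p₃ ≠ p₄)
    (hI : ∀ (P : SAW.DomainSAW (ΩV lo hi VS) 1 p₁ p₃) (Q : SAW.DomainSAW (ΩV lo hi VS) 1 p₂ p₄),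
      ∃ v, v ∈ P.walk.support ∧ v ∈ Q.walk.support) :
    SAW.weight (ΩV lo hi VS) 1 p₁ p₃ Set.univ * SAW.weight (ΩV lo hi VS) 1 p₂ p₄ Set.univ ≤
      SAW.weight (ΩV lo hi VS) 1 p₁ p₂ Set.univ * SAW.weight (ΩV lo hi VS) 1 p₃ p₄ Set.univ := by
  simp only [weight_univ_eq_pathKernel]
  exact interlacedTP2_of_fullCheckVTR (adj_ΩV_iff hV hconn) hVS hct hall (xc_mem_interval hμ).1
    (xc_mem_interval hμ).2 p₁ p₂ p₃ p₄ n12 n13 n14 n23 n24 n34 (interlaced_of_domainSAW hI)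

end Summit.CriticalPhenomena.SAWScalingLimit.Theorems.BoundaryTP2.Negative.Cert
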